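import Summits.PneNP.PneNP.Theorems.ConvexRankGatesCliqueExtLowerBoundStubReferee
import Summits.PneNP.PneNP.Theorems.ConvexRankGatesCliqueExtLowerBoundWidthThresholdDefs
import Summits.PneNP.PneNP.Theorems.CliqueExtLowerBound.Negative.AnchoredThetaCounting
import Mathlib

/-!
# Stub `unitCnf_pos_count` of line `width-threshold-certificate-sparsity`
(crux `CliqueExtLowerBound`, stmt-PneNP-10682; lead c13, target `LocalityMustGrow`)

THE POSITIVE COUNT of the tightness fact "the locality threshold must grow with `c`". Among the
positives of the referee pair — `posGraphs m k`, the clique vectors of the `k`-subsets of `Fin m`,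
`k = ⌈m^{1/4}⌉₊` — those in which every edge of a pattern `P` living inside a `j`-vertex set `U`
is on include `cliqueVec Q` for every `k`-set `Q ⊇ U`, i.e. at least `C(m-j, k-j)` of them
(`cliqueVec` is injective on the `k`-sets for `k ≥ 2`, from `Referee.card_posGraphs`; supersets
are counted by `Negative.card_filter_supset`). Numerics: `C(m,k) · (k+1-j)^j ≤ m^j · C(m-j,k-j)`
(`C(m,k) C(k,j) = C(m,j) C(m-j,k-j)`, `(k+1-j)^j ≤ k!/(k-j)! = j! C(k,j)` and
`j! C(m,j) = m!/(m-j)! ≤ m^j`), and with `m ≤ k^4`, `(k-1)^4 < m`, `3j + 1 ≤ 4(c+1)`: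
`m^j ≤ k^{4j} < 8 (k-1)^{4(c+1)} (k+1-j)^j ≤ 8 m^{c+1} (k+1-j)^j` once `k ≥ 16^j + 2j + 2`, so
`C(m,k) < 8 m^{c+1} C(m-j,k-j)` eventually.

* §1 counting: `cliqueVec_injOn`, `choose_sub_le_card_filter` (`C(m-j,k-j) ≤ #filter`);
* §2 numerics: `choose_mul_pow_le` (the binomial ratio), `pow_lt_of_large` (the pure-`k`
  inequality), `eventually_numerics`;
* §3 the registered sub-goal `unitCnf_pos_count`.
-/

set_option linter.dupNamespace false

open Literature.Computability.Complexity Filter Finset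
open Summit.PneNP.PneNP.Theorems.CliqueExtLowerBound.WidthThreshold

noncomputable section

namespace Summit.PneNP.PneNP.Theorems.CliqueExtLowerBound.WidthThreshold.UnitCnfPos

/-! ## §1 Counting: the cliques on supersets of `U` have all of `P` on -/

/-- `cliqueVec` is injective on the `k`-subsets of `Fin m` for `k ≥ 2` (there are `C(m,k)` positive
graphs, `Referee.card_posGraphs`). [folklore] -/
theorem cliqueVec_injOn {m k : ℕ} (hk : 2 ≤ k) :
    Set.InjOn (cliqueVec (m := m)) ↑(powersetCard k (univ : Finset (Fin m))) := by
  refine Finset.card_image_iff.1 ?_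
  rw [Finset.card_powersetCard, Finset.card_univ, Fintype.card_fin, ← Referee.card_posGraphs hk]
  rfl

/-- If the pattern `P` lives inside `U`, `#U = j ≤ k` and `2 ≤ k`, then at least `C(m-j, k-j)`
positive graphs have all of `P` on: the clique vectors of the `k`-sets `Q ⊇ U`. [folklore] -/
theorem choose_sub_le_card_filter {m k j : ℕ} (hk : 2 ≤ k) (hjk : j ≤ k) (U : Finset (Fin m))
    (hU : #U = j) (P : Finset (EV m)) (hP : ∀ e ∈ P, ∀ v ∈ (e : Sym2 (Fin m)), v ∈ U) :
    (m - j).choose (k - j) ≤ #((posGraphs m k).filter fun x => ∀ e ∈ P, x e = true) :=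
  calc (m - j).choose (k - j)
      = #(((univ : Finset (Fin m)).powersetCard k).filter fun K => U ⊆ K) := by
        rw [Negative.card_filter_supset U k (by omega), hU, Fintype.card_fin]
    _ = #((((univ : Finset (Fin m)).powersetCard k).filter fun K => U ⊆ K).image cliqueVec) :=
        (Finset.card_image_of_injOn ((cliqueVec_injOn hk).mono
          (Finset.coe_subset.2 (Finset.filter_subset _ _)))).symm
    _ ≤ #((posGraphs m k).filter fun x => ∀ e ∈ P, x e = true) :=
        Finset.card_le_card fun x hx => by
          rw [Finset.mem_image] at hx
          obtain ⟨K, hK, rfl⟩ := hx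
          rw [Finset.mem_filter] at hK
          rw [Finset.mem_filter]
          refine ⟨Finset.mem_image_of_mem _ hK.1, fun e he => ?_⟩
          simp only [cliqueVec, decide_eq_true_eq]
          exact fun v hv => hK.2 (hP e he v hv)

/-! ## §2 Numerics -/

/-- The binomial ratio, cross-multiplied: `C(m,k) · (k+1-j)^j ≤ m^j · C(m-j, k-j)` for `j ≤ k`
(`C(m,k) C(k,j) = C(m,j) C(m-j,k-j)`, `(k+1-j)^j ≤ k!/(k-j)! = j! C(k,j)` and
`j! C(m,j) = m!/(m-j)! ≤ m^j`). [folklore] -/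
theorem choose_mul_pow_le {m k j : ℕ} (hjk : j ≤ k) :
    m.choose k * (k + 1 - j) ^ j ≤ m ^ j * (m - j).choose (k - j) :=
  calc m.choose k * (k + 1 - j) ^ j ≤ m.choose k * k.descFactorial j :=
        Nat.mul_le_mul_left _ (Nat.pow_sub_le_descFactorial k j)
    _ = j.factorial * (m.choose k * k.choose j) := by
        rw [Nat.descFactorial_eq_factorial_mul_choose]; ring
    _ = j.factorial * (m.choose j * (m - j).choose (k - j)) := by rw [Nat.choose_mul hjk]
    _ = m.descFactorial j * (m - j).choose (k - j) := by
        rw [Nat.descFactorial_eq_factorial_mul_choose]; ring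
    _ ≤ m ^ j * (m - j).choose (k - j) := Nat.mul_le_mul_right _ (Nat.descFactorial_le_pow m j)

/-- The pure-`k` inequality: if `3j < 4(c+1)` and `k ≥ 16^j + 2j + 2` then
`k^{4j} < 8 (k-1)^{4(c+1)} (k+1-j)^j` (`k ≤ 2(k-1)`, `k ≤ 2(k+1-j)`, so
`2^{4j} k^{4j} < 8(k-1) · 2^{3j}(k-1)^{3j} · 2^j (k+1-j)^j` as `2^{4j} < 8(k-1)`, and
`3j + 1 ≤ 4(c+1)`). [folklore] -/
theorem pow_lt_of_large {c j k : ℕ} (hcj : 3 * j < 4 * (c + 1)) (hk : 16 ^ j + 2 * j + 2 ≤ k) :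
    k ^ (4 * j) < 8 * (k - 1) ^ (4 * (c + 1)) * (k + 1 - j) ^ j := by
  have h16 : (2 : ℕ) ^ (4 * j) = 16 ^ j := by rw [pow_mul]; norm_num
  have hB0 : 0 < 16 ^ j := by positivity
  have hk0 : 0 < k := by omega
  have h1 : k ≤ 2 * (k - 1) := by omega
  have h2 : k ≤ 2 * (k + 1 - j) := by omega
  have h3 : k ^ (3 * j) ≤ 2 ^ (3 * j) * (k - 1) ^ (3 * j) := by
    rw [← mul_pow]; exact Nat.pow_le_pow_left h1 _
  have h4 : k ^ j ≤ 2 ^ j * (k + 1 - j) ^ j := by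
    rw [← mul_pow]; exact Nat.pow_le_pow_left h2 _
  have h5 : (k - 1) ^ (3 * j + 1) ≤ (k - 1) ^ (4 * (c + 1)) :=
    Nat.pow_le_pow_right (by omega) (by omega)
  have h6 : 2 ^ (4 * j) < 8 * (k - 1) := by rw [h16]; omega
  have hpos : 0 < k ^ (3 * j) * k ^ j := Nat.mul_pos (pow_pos hk0 _) (pow_pos hk0 _)
  refine lt_of_mul_lt_mul_left ?_ (Nat.zero_le (2 ^ (4 * j)))
  calc 2 ^ (4 * j) * k ^ (4 * j) = 2 ^ (4 * j) * (k ^ (3 * j) * k ^ j) := by ring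
    _ < 8 * (k - 1) * (k ^ (3 * j) * k ^ j) := mul_lt_mul_of_pos_right h6 hpos
    _ ≤ 8 * (k - 1) * (2 ^ (3 * j) * (k - 1) ^ (3 * j) * (2 ^ j * (k + 1 - j) ^ j)) :=
        Nat.mul_le_mul_left _ (Nat.mul_le_mul h3 h4)
    _ = 2 ^ (4 * j) * (8 * (k - 1) ^ (3 * j + 1) * (k + 1 - j) ^ j) := by ring
    _ ≤ 2 ^ (4 * j) * (8 * (k - 1) ^ (4 * (c + 1)) * (k + 1 - j) ^ j) :=
        Nat.mul_le_mul_left _ (Nat.mul_le_mul_right _ (Nat.mul_le_mul_left _ h5))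

/-- Eventually in `m`, with `k = ⌈m^{1/4}⌉₊`: `j ≤ k`, `2 ≤ k`, `k ≤ m`, `1 ≤ m`, and (given
`3j < 4(c+1)`) `C(m,k) < 8 m^{c+1} C(m-j, k-j)` (`m ≤ k^4` and `(k-1)^4 < m` by
`Referee.ceil_sandwich`; then `choose_mul_pow_le` and `pow_lt_of_large`). [folklore] -/
theorem eventually_numerics {c j : ℕ} (hcj : 3 * j < 4 * (c + 1)) : ∀ᶠ m : ℕ in atTop,
    j ≤ ⌈(m : ℝ) ^ (1 / 4 : ℝ)⌉₊ ∧ 2 ≤ ⌈(m : ℝ) ^ (1 / 4 : ℝ)⌉₊ ∧ ⌈(m : ℝ) ^ (1 / 4 : ℝ)⌉₊ ≤ m ∧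
      1 ≤ m ∧ m.choose ⌈(m : ℝ) ^ (1 / 4 : ℝ)⌉₊ <
        8 * m ^ (c + 1) * (m - j).choose (⌈(m : ℝ) ^ (1 / 4 : ℝ)⌉₊ - j) := by
  filter_upwards [eventually_ge_atTop ((16 ^ j + 2 * j + 2) ^ 4)] with m hm
  have hB0 : 0 < 16 ^ j := by positivity
  have hB1 : 1 ≤ (16 ^ j + 2 * j + 2) ^ 4 := Nat.one_le_pow _ _ (by omega)
  have hm1 : 1 ≤ m := le_trans hB1 hm
  obtain ⟨hmk, hkm⟩ := Referee.ceil_sandwich (m := m) hm1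
  set k := ⌈(m : ℝ) ^ (1 / 4 : ℝ)⌉₊ with hk
  have hkB : 16 ^ j + 2 * j + 2 ≤ k :=
    (Nat.pow_le_pow_iff_left (by norm_num : (4 : ℕ) ≠ 0)).1 (hm.trans hmk)
  have hk2 : 2 ≤ k := by omega
  have hjk : j ≤ k := by omega
  have hk_le_m : k ≤ m := by
    have : k - 1 ≤ (k - 1) ^ 4 := Nat.le_self_pow (by norm_num) _
    omega
  refine ⟨hjk, hk2, hk_le_m, hm1, ?_⟩
  -- `m^j < 8 m^{c+1} (k+1-j)^j`
  have key : m ^ j < 8 * m ^ (c + 1) * (k + 1 - j) ^ j :=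
    calc m ^ j ≤ (k ^ 4) ^ j := Nat.pow_le_pow_left hmk j
      _ = k ^ (4 * j) := by rw [← pow_mul]
      _ < 8 * (k - 1) ^ (4 * (c + 1)) * (k + 1 - j) ^ j := pow_lt_of_large hcj hkB
      _ = 8 * ((k - 1) ^ 4) ^ (c + 1) * (k + 1 - j) ^ j := by rw [← pow_mul]
      _ ≤ 8 * m ^ (c + 1) * (k + 1 - j) ^ j :=
          Nat.mul_le_mul_right _ (Nat.mul_le_mul_left _ (Nat.pow_le_pow_left hkm.le _))
  have hC : 0 < (m - j).choose (k - j) := Nat.choose_pos (by omega)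
  -- `C(m,k) (k+1-j)^j ≤ m^j C(m-j,k-j) < 8 m^{c+1} (k+1-j)^j C(m-j,k-j)`
  have h2 : m.choose k * (k + 1 - j) ^ j <
      8 * m ^ (c + 1) * (m - j).choose (k - j) * (k + 1 - j) ^ j :=
    calc m.choose k * (k + 1 - j) ^ j ≤ m ^ j * (m - j).choose (k - j) := choose_mul_pow_le hjk
      _ < 8 * m ^ (c + 1) * (k + 1 - j) ^ j * (m - j).choose (k - j) :=
          mul_lt_mul_of_pos_right key hC
      _ = 8 * m ^ (c + 1) * (m - j).choose (k - j) * (k + 1 - j) ^ j := by ring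
  exact lt_of_mul_lt_mul_right h2 (Nat.zero_le _)

/-! ## §3 The registered sub-goal -/

open Classical in
/-- **The positive count** (registered sub-goal `unitCnf_pos_count` of line
`width-threshold-certificate-sparsity`, lead c13, target `LocalityMustGrow`): if `3j < 4(c+1)` then,
for all large `m`, for every vertex set `U` of size `j` and every edge pattern `P` inside `U`, the
bare `⌈m^{1/4}⌉₊`-cliques with all of `P` on are MORE than a `1/(8m^{c+1})` fraction of all the
bare cliques (`≥ C(m-j, k-j)` of the `C(m,k)`, `choose_sub_le_card_filter`, and
`C(m,k) < 8 m^{c+1} C(m-j,k-j)` eventually, `eventually_numerics`). [folklore] -/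
theorem unitCnf_pos_count : ∀ c j : ℕ, 3 * j < 4 * (c + 1) → ∀ᶠ m : ℕ in atTop,
    ∀ U : Finset (Fin m), #U = j → ∀ P : Finset (EV m), (∀ e ∈ P, ∀ v ∈ (e : Sym2 (Fin m)), v ∈ U) →
      (1 / (8 * (m : ℝ) ^ (c + 1))) * #(posGraphs m ⌈(m : ℝ) ^ (1 / 4 : ℝ)⌉₊) <
        #((posGraphs m ⌈(m : ℝ) ^ (1 / 4 : ℝ)⌉₊).filter fun x => ∀ e ∈ P, x e = true) := by
  intro c j hcj
  filter_upwards [eventually_numerics hcj] with m hm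
  obtain ⟨hjk, hk2, -, hm1, hnum⟩ := hm
  intro U hU P hP
  set k := ⌈(m : ℝ) ^ (1 / 4 : ℝ)⌉₊ with hk
  have hcount := choose_sub_le_card_filter hk2 hjk U hU P hP
  have h8 : (0 : ℝ) < 8 * (m : ℝ) ^ (c + 1) := mul_pos (by norm_num) (pow_pos (Nat.cast_pos.2 hm1) _)
  rw [Referee.card_posGraphs hk2, one_div_mul_eq_div, div_lt_iff₀ h8]
  calc ((m.choose k : ℕ) : ℝ) < ((8 * m ^ (c + 1) * (m - j).choose (k - j) : ℕ) : ℝ) := by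
        exact_mod_cast hnum
    _ = (((m - j).choose (k - j) : ℕ) : ℝ) * (8 * (m : ℝ) ^ (c + 1)) := by push_cast; ring
    _ ≤ _ := mul_le_mul_of_nonneg_right (by exact_mod_cast hcount) h8.le

end Summit.PneNP.PneNP.Theorems.CliqueExtLowerBound.WidthThreshold.UnitCnfPos

end
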